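import Summits.SmoothPoincare4.SmoothPoincare4.Theorems.CongruenceShadowsShadowsStandardStubClassTwoLevels
import HarnessLib

/-!
# Helper `helper_pLevelLayerIsClassTwo` of line `prym-layer-stable-rank` for crux
`CongruenceShadows.ShadowsStandard` (item stmt-SmoothPoincare4-14593, route route-SmoothPoincare4-CongruenceShadows)

**Every chief layer directly below the abelian stratum with `p`-group quotient is class-two.**
Let `S = SurfaceGroup g`, `M' < M` characteristic subgroups of `S` with `M'` of finite index, the
layer `M/M'` an `Aut S`-chief factor (no characteristic subgroup strictly between), `⁅S,S⁆ ≤ M` (the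
upper level lies in the abelian stratum, e.g. `M = [S,S]·S^p`) and `[S : M'] = p^k` (`p` prime). Then
`γ₃S = (⊤ : Subgroup S).lowerCentralSeries 2 ≤ M'`.

Proof. `X = ⁅M, S⁆ ⊔ M'` is characteristic with `M' ≤ X ≤ M`. If `X = M`, the image `A` of `M` in
the finite `p`-group (hence nilpotent) `S/M'` satisfies `⁅A, S/M'⁆ = A`, which forces `A = 1`, i.e.
`M ≤ M'`, absurd; so by the chief hypothesis `X = M'`, i.e. the layer is CENTRAL, `⁅M, S⁆ ≤ M'`, and
`γ₃S = ⁅⁅S,S⁆, S⁆ ≤ ⁅M, S⁆ ≤ M'`.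

Consequence for the line (`wildLayerBelowAbelianLevel_standard`, via the landed
`stub_classTwoLevels`, p124281): in the chief-layer descent of `ShadowsStandard`, every WILD layer met
directly below a level of the abelian stratum — in particular directly below the first deep level
`[S,S]·S^p`, where `S/M'` is a `p`-group because `M/M'` is a `p`-layer — is standard for every
`(3+3m; m+1)` group trisection of the trivial group and every `m`. The first wild layers NOT covered
sit below `[S,S]·S^n` with `n` composite (e.g. `n = 6`, genus `3`: the `(ℤ/3)⁶`-new part of
`H₁([S,S]S⁶; 𝔽₂)`), where the layer need not be central.

The file declares theorems only.
-/

set_option linter.dupNamespace false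

noncomputable section

namespace Summit.SmoothPoincare4.SmoothPoincare4.Theorems.ShadowsStandard.PrymLayerStableRank

open Literature.Topology.FourManifolds
open Subgroup

/-- The join of two characteristic subgroups is characteristic. [folklore] -/
theorem characteristic_sup {G : Type*} [Group G] {A B : Subgroup G} (hA : A.Characteristic)
    (hB : B.Characteristic) : (A ⊔ B).Characteristic := by
  rw [Subgroup.characteristic_iff_map_eq]
  intro φ
  rw [Subgroup.map_sup, (Subgroup.characteristic_iff_map_eq.1 hA) φ,
    (Subgroup.characteristic_iff_map_eq.1 hB) φ]

/-- In a nilpotent group a subgroup `A` with `⁅A, G⁆ = A` is trivial (`A ≤ γₙ G` for every `n`).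
[folklore] -/
theorem eq_bot_of_commutator_top_eq {G : Type*} [Group G] [hG : Group.IsNilpotent G]
    {A : Subgroup G} (h : ⁅A, (⊤ : Subgroup G)⁆ = A) : A = ⊥ := by
  obtain ⟨n, hn⟩ := Subgroup.nilpotent_iff_lowerCentralSeries.1 hG
  have key : ∀ k, A ≤ (⊤ : Subgroup G).lowerCentralSeries k := by
    intro k
    induction k with
    | zero => exact le_top
    | succ k ih =>
      rw [Subgroup.lowerCentralSeries_succ, ← h]
      exact Subgroup.commutator_mono ih le_rfl
  exact le_bot_iff.1 ((key n).trans hn.le)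

/-- **REGISTERED HELPER `helper_pLevelLayerIsClassTwo`**: an `Aut S`-chief layer `M/M'` of
`S = SurfaceGroup g` directly below a level `M ⊇ ⁅S,S⁆` of the abelian stratum, with `S/M'` a finite
`p`-group (`[S:M'] = p^k`, `p` prime), is central, hence `γ₃S ≤ M'`. [folklore] -/
theorem helper_pLevelLayerIsClassTwo :
    ∀ (g : ℕ) (M M' : Subgroup (SurfaceGroup g)), M.Characteristic → M'.Characteristic →
      M'.FiniteIndex → M' < M →
      (∀ X : Subgroup (SurfaceGroup g), X.Characteristic → M' < X → X ≤ M → X = M) →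
      ⁅(⊤ : Subgroup (SurfaceGroup g)), (⊤ : Subgroup (SurfaceGroup g))⁆ ≤ M →
      ∀ p k : ℕ, p.Prime → M'.index = p ^ k →
      (⊤ : Subgroup (SurfaceGroup g)).lowerCentralSeries 2 ≤ M' := by
  intro g M M' hM hM' hM'f hlt hchief hab p k hp hpk
  haveI : M.Characteristic := hM
  haveI : M'.Characteristic := hM'
  haveI : M'.FiniteIndex := hM'f
  -- Step 1: the layer is central, `⁅M, ⊤⁆ ≤ M'`
  have hcen : ⁅M, (⊤ : Subgroup (SurfaceGroup g))⁆ ≤ M' := by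
    by_contra hcen
    set X : Subgroup (SurfaceGroup g) := ⁅M, (⊤ : Subgroup (SurfaceGroup g))⁆ ⊔ M' with hX
    have hXc : X.Characteristic := characteristic_sup inferInstance hM'
    have hXM : X ≤ M := sup_le (Subgroup.commutator_le_left M ⊤) hlt.le
    have hlt' : M' < X := by
      refine lt_of_le_of_ne le_sup_right fun h => hcen ?_
      rw [h]
      exact le_sup_left
    have hXeq : X = M := hchief X hXc hlt' hXM
    -- pass to the finite `p`-group `S ⧸ M'`
    haveI : Fact p.Prime := ⟨hp⟩
    have hP : IsPGroup p (SurfaceGroup g ⧸ M') := IsPGroup.of_card hpk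
    haveI : Group.IsNilpotent (SurfaceGroup g ⧸ M') := hP.isNilpotent
    have hker : M'.map (QuotientGroup.mk' M') = ⊥ := by
      rw [Subgroup.map_eq_bot_iff, QuotientGroup.ker_mk']
    have htop : (⊤ : Subgroup (SurfaceGroup g)).map (QuotientGroup.mk' M') = ⊤ :=
      Subgroup.map_top_of_surjective _ (QuotientGroup.mk'_surjective M')
    have hA : ⁅M.map (QuotientGroup.mk' M'), (⊤ : Subgroup (SurfaceGroup g ⧸ M'))⁆ =
        M.map (QuotientGroup.mk' M') := by
      have e := congrArg (Subgroup.map (QuotientGroup.mk' M')) hXeq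
      rw [hX, Subgroup.map_sup, Subgroup.map_commutator, hker, htop, sup_bot_eq] at e
      exact e
    have hAbot : M.map (QuotientGroup.mk' M') = ⊥ := eq_bot_of_commutator_top_eq hA
    have hMM' : M ≤ M' := by
      rw [Subgroup.map_eq_bot_iff, QuotientGroup.ker_mk'] at hAbot
      exact hAbot
    exact absurd hMM' (not_le_of_gt hlt)
  -- Step 2: `γ₃ = ⁅⁅⊤,⊤⁆, ⊤⁆ ≤ ⁅M, ⊤⁆ ≤ M'`
  refine le_trans ?_ hcen
  rw [Subgroup.lowerCentralSeries_succ, Subgroup.lowerCentralSeries_succ,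
    Subgroup.lowerCentralSeries_zero]
  exact Subgroup.commutator_mono hab le_rfl

/-- **Wild layers directly below the abelian stratum are standard** (for the line's descent): with
`M, M'` as in `helper_pLevelLayerIsClassTwo` inside `S = SurfaceGroup (3+3m)`, every `(3+3m; m+1)`
group trisection `K` of the trivial group has `∃ ψ ∈ Aut S, ∀ i, ψ(Nᵢ ⊔ M') = Kᵢ ⊔ M'` — by the
landed class-two stratum `stub_classTwoLevels` (p124281). Covers the line's first wild instance
`(m, M, p) = (0, [S,S]S², 2)` and, for every `m` and prime `p`, every chief layer directly below
`[S,S]·S^p`. [folklore] -/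
theorem wildLayerBelowAbelianLevel_standard (m : ℕ) (K : TrisectionKernels (3 + 3 * m))
    (hK : IsGroupTrisection (3 + 3 * m) (m + 1) (PUnit : Type) K)
    (M M' : Subgroup (SurfaceGroup (3 + 3 * m))) (hM : M.Characteristic) (hM' : M'.Characteristic)
    (hM'f : M'.FiniteIndex) (hlt : M' < M)
    (hchief : ∀ X : Subgroup (SurfaceGroup (3 + 3 * m)), X.Characteristic → M' < X → X ≤ M → X = M)
    (hab : ⁅(⊤ : Subgroup (SurfaceGroup (3 + 3 * m))), (⊤ : Subgroup (SurfaceGroup (3 + 3 * m)))⁆ ≤ M)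
    (p k : ℕ) (hp : p.Prime) (hpk : M'.index = p ^ k) :
    ∃ ψ : SurfaceGroup (3 + 3 * m) ≃* SurfaceGroup (3 + 3 * m), ∀ i : Fin 3,
      (s4Kernels.stabilizeIter m i ⊔ M').map ψ.toMonoidHom = K i ⊔ M' :=
  stub_classTwoLevels m K hK M' hM'
    (helper_pLevelLayerIsClassTwo (3 + 3 * m) M M' hM hM' hM'f hlt hchief hab p k hp hpk)

end Summit.SmoothPoincare4.SmoothPoincare4.Theorems.ShadowsStandard.PrymLayerStableRank

end
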